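import Summits.CriticalPhenomena.CardyFormulaZ2.Theorems.CardyComplexConeParafermionToSLESixFamiliesIicTouchPin
import Summits.CriticalPhenomena.CardyFormulaZ2.Theorems.CardyComplexConeParafermionToSLESixFamiliesIicTight
import Literature.Probability.Percolation.BondInterfaceFaceDomain
import HarnessLib

/-!
# The pinned slit touch law `TouchLawPosPin` and the corrected stub S6 (line `iic-trace-flux-pairing`, crux `ParafermionToSLESixFamilies`, stmt-CriticalPhenomena-11389)

Route `CardyComplexCone` (sub-problem `CriticalPhenomena/CardyFormulaZ2`), crux
`Summit.CriticalPhenomena.CardyFormulaZ2.Theses.CardyComplexCone.ParafermionToSLESixFamilies`, line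
`iic-trace-flux-pairing`, stub S6 `stub_sleLawOnRectilinear :
(∀ D, IsRectilinear D → TouchLawPos D) → TightOnRectilinear ∧ IdentOnRectilinear` (vocabulary
`Theorems/…IicDefs.lean`; tightness half `…IicTight.lean`; touch martingales `…IicTouchPin.lean`).

This is a DEFINITIONS module (nothing asserted) recording the outcome of the audit of the identification half of S6.
The intended proof conditions the monotone touch events on the exploration prefix; by `…IicTouchPin.lean`
(`condExp_touchCount_ae_eq_touchFunctionalPin`, `martingale_touchFunctionalPin`) these conditional quantities are the
PINNED touch functionals `touchFunctionalPin (Λ δ) (ω₀ ∩ R_n) (R_n ∖ ω₀) g` of the pinned slit data `(Λ δ, O_n, C_n)`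
met along the exploration — critical percolation in the slit domain `D ∖ γ[0, n+1]` with edge-wise boundary conditions,
rendered by no admissible `DiscreteDobrushin` datum (`…SlitBridge.not_isZdAdmissible_rendering_of_pin`) and living on
carriers that are neither rectilinear nor fixed as `δ → 0`. The hypothesis `TouchLawPos D` (admissible families of the
FIXED carrier `D`, one subsequence and one amplitude PER FAMILY) constrains the `n = 0` term of these martingales and
nothing else: for the intended proof it is idle, and `IdentOnRectilinear` given it is the SLE₆ identification
conjecture on rectilinear polygons. What the identification consumes is typed here:

* `prefixTrace`, `prefixTip`, `tipAccess` — the slit geometry of an exploration prefix (polyline trace, tip, and the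
  unused medial darts at the tip, which single out the tip's prime end in the unexplored component even at a doubly
  visited medial vertex);
* `HasPinTouchDensityAt U T p q y ρ` — the covariant weight-`1/3` density `|ψ′/ψ|^{1/3}` of the two-pointed simply
  connected domain `(U; p, q)` at a boundary point `y` (slit counterpart of `HasTouchDensityAt`, same formula, with an
  existence conjunct so that degenerate input makes it false rather than vacuous);
* `TouchLawPosPin D` — the touch law for the pinned slit data, UNIFORM IN THE PREFIX, with ONE subsequence and ONE
  amplitude per (family, window, mesh sequence): the quantifier shape of `TouchLawPos` plus slit uniformity; active
  windows get `|N − c ∫ g ρ_U ds| ≤ ε`, sealed windows `|N| ≤ ε`;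
* `S6Corrected` — the corrected S6, `(∀ D, IsRectilinear D → TouchLawPosPin D) → TightOnRectilinear ∧ IdentOnRectilinear`,
  as a `Prop` for the lead's reshape (its first conjunct is the landed `tightOnRectilinear`). The bridge
  `TouchLawPos D → TouchLawPosPin D` ("RSW ratio-stability of order-one monotone quantities; rectilinear approximants
  of the collared slit domain; six-arm collar estimate", the card) is research content that the registered S6 hid
  under an idle hypothesis; it belongs in a stub of its own.
-/

noncomputable section

namespace Summit.CriticalPhenomena.CardyFormulaZ2.Cruxes.ParafermionToSLESixFamilies.IicTraceFluxPairing

open scoped Topology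
open Filter MeasureTheory Set Metric
open UpperHalfPlane (upperHalfPlaneSet)
open Literature.Probability Literature.Probability.LatticeModels Literature.Probability.Percolation
open Literature.Probability.LatticeModels.DiscreteDobrushin
open Literature.Probability.RandomPlanarGeometry
open Summit.CriticalPhenomena.CardyFormulaZ2.Cruxes.ParafermionToSLESixFamilies.CaratheodoryNetSlitUniformity
  (revealedFreeEdges)

/-! ### §3 The slit geometry of an exploration prefix and the pinned slit touch law -/

/-- The polyline TRACE of the exploration prefix `γ[0, n+1]` of `E` in `ω` (the first `n + 2` medial vertices joined
by their darts), a compact subset of the closed face domain. -/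
def prefixTrace (E : DiscreteDobrushin) (n : ℕ) (ω : BondConfig (Site 2)) : Set ℂ :=
  {z | ∃ (i : ℕ) (h : i + 1 < (explorationPrefix E n ω).length),
    z ∈ segment ℝ (medialPoint E.δ ((explorationPrefix E n ω)[i])) (medialPoint E.δ ((explorationPrefix E n ω)[i + 1]))}

/-- The TIP of the prefix: its last medial point (junk `0` for an empty exploration). -/
def prefixTip (E : DiscreteDobrushin) (n : ℕ) (ω : BondConfig (Site 2)) : ℂ :=
  ((explorationPrefix E n ω).getLast?.map (medialPoint E.δ)).getD 0

/-- The TIP ACCESS of the prefix: the open medial edges (darts of inner faces, either orientation) at the tip that the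
prefix has not used. They all lie in one complementary sector at the tip — the one into which the exploration
continues — and so single out the tip's PRIME END in the unexplored region even when the tip is a doubly visited medial
vertex (the square-lattice "both sides of a cluster edge" event, one step in six): normalising a uniformizer by
approach along this set is normalising at the Loewner tip `W_t`. -/
def tipAccess (E : DiscreteDobrushin) (n : ℕ) (ω : BondConfig (Site 2)) : Set ℂ :=
  match (explorationPrefix E n ω).getLast? with
  | none => ∅
  | some mt => ⋃ (m' : MedialVertex) (_ : (E.IsMedialStep mt m' ∨ E.IsMedialStep m' mt) ∧
      ¬ ([mt, m'] <:+: explorationPrefix E n ω) ∧ ¬ ([m', mt] <:+: explorationPrefix E n ω)),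
      openSegment ℝ (medialPoint E.δ mt) (medialPoint E.δ m')

/-- The covariant weight-`1/3` TOUCH DENSITY of a two-pointed simply connected domain `(U; p, q)` at the boundary
point `y`, the prime end at the tip `p` being specified by an access set `T ⊆ U` accumulating at `p`: there is a conformal
`φ : ℍ → U` with `φ⁻¹ → 0` along `T` at `p` and `φ → q` at `∞`, and for every such `φ` (they differ by dilations of
`ℍ`, which do not change `ψ′/ψ`), `|ψ′(z)/ψ(z)|^{1/3} → ρ` as `z → y` inside `U`, `ψ = φ⁻¹`. The slit/pinned
counterpart of `HasTouchDensityAt D y ρ` (same formula). Degenerate input makes the predicate FALSE rather than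
vacuous: if `U` is empty or not simply connected, or `q` is not a prime end of `U`, no such `φ` exists; if `p ∉ closure T`
the tip normalisation is void, the admissible `φ` then differ by translations as well and the universal clause fails;
if `y ∉ closure U` the density clause is void — the consumer must evaluate at points of `∂U` (as `TouchLawPosPin` does). -/
def HasPinTouchDensityAt (U T : Set ℂ) (p q y : ℂ) (ρ : ℝ) : Prop :=
  (∃ φ : ConformalEquiv upperHalfPlaneSet U,
      Tendsto (fun z : ℂ => φ.symm z) (𝓝[T] p) (𝓝 0) ∧ φ.HasBoundaryValueAtInfty q) ∧
  ∀ φ : ConformalEquiv upperHalfPlaneSet U,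
    Tendsto (fun z : ℂ => φ.symm z) (𝓝[T] p) (𝓝 0) → φ.HasBoundaryValueAtInfty q →
      Tendsto (fun z : ℂ => ‖deriv (fun w : ℂ => φ.symm w) z / φ.symm z‖ ^ ((1:ℝ) / 3)) (𝓝[U] y) (𝓝 ρ)

/-- A family in the sense of the crux is a `ZdDiscretisationFamily` (same six fields). -/
theorem IsFamily.zd {D : DobrushinDomain} {Λ : ℝ → DiscreteDobrushin} (hΛ : IsFamily D Λ) :
    ZdDiscretisationFamily D Λ :=
  ⟨hΛ.1, hΛ.2.1, hΛ.2.2.1, hΛ.2.2.2.1, hΛ.2.2.2.2.1, hΛ.2.2.2.2.2⟩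

/-- **`TouchLawPosPin D` — the SLIT-UNIFORM PINNED TOUCH LAW near the exploration target (proposed repaired hypothesis of
S6; NOT ASSERTED).** For every admissible family `Λ` of `D`, every flat free window `(m, η, a, b)` and every mesh
sequence `u_k → 0⁺` there are ONE subsequence `s` and ONE amplitude `c > 0` such that for every test function `g`
supported in the window box and all `r, ε > 0`, for all large `k` (mesh `δ = u (s k)`) and EVERY exploration prefix
`γ[0, n+1]` of `Λ δ` (every `ω₀`, every `n` before the exit) whose trace stays `r`-away from the closed window box, with
`U` = the connected component of (face-domain carrier of `Λ δ`) ∖ (prefix trace) containing the window point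
`m + (b/2)η`, `T` = the tip access, `q` = the exploration target `b_δ` (`pt 1` of the face domain),
`N` = the pinned touch functional `touchFunctionalPin (Λ δ) (ω₀ ∩ R_n) (R_n ∖ ω₀) g` of the revealed data
(= `E[touchCount g ∣ 𝓕_n](ω₀)`, `…IicTouchPin.condExp_touchCount_ae_eq_touchFunctionalPin`):
* ACTIVE window (`T ⊆ U`, the exploration continues into the window's component): the covariant density of
  `(U; tip, b_δ)` exists along the window pushed onto `∂U` (the face-domain boundary runs parallel to the flat side at a
  distance `d ∈ [0, δ]`) and `|N − c ∫ g ρ ds| ≤ ε`;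
* SEALED window (`¬ T ⊆ U`): `|N| ≤ ε` (indeed `N = 0`: no future dart can enter `U`, so no window touch corner is
  passed, Duminil-Copin 2012 Prop. 5).
Quantifier shape = that of `TouchLawPos D` (family, window, mesh sequence `u`, then ONE subsequence `s` and ONE
amplitude `c`, then the test functions), plus UNIFORMITY IN THE PREFIX: the same `s`, `c` serve every pinned slit datum
met along the exploration (deterministically, for every `ω₀` and `n`). This is the "slit uniformity = RSW ratio-stability
of order-one monotone quantities" the card assigns to S6, made a hypothesis: pinned slit data instead of admissible data
of the fixed carrier `D` (`…SlitBridge.not_isZdAdmissible_rendering_of_pin`), one amplitude for all prefixes instead of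
one per family. Its `n = 0` instance is (the face-domain form of) `TouchLawPos`. This is the statement the Doob-martingale identification consumes: with it,
`t ↦ c ∫ g ρ_{D_t} ds` is a continuous martingale for every subsequential limit, and the far-field expansion
`ρ_t(y) = |y|^{-1/3}(1 + W_t/(3y) + (2W_t²/9 − 4t/3)/y² + …)` (half-plane coordinates, `b = ∞`) forces
`E W_t = 0`, `E W_t² = 6t` (`kappa_detector`). -/
def TouchLawPosPin (D : DobrushinDomain) : Prop :=
  ∀ (Λ : ℝ → DiscreteDobrushin) (hΛ : IsFamily D Λ) (m η : ℂ) (a b : ℝ), IsFlatFreeWindow D m η a b →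
    ∀ u : ℕ → ℝ, Tendsto u atTop (𝓝[>] (0:ℝ)) →
      ∃ (s : ℕ → ℕ) (c : ℝ), StrictMono s ∧ 0 < c ∧
        ∀ g : ℂ → ℝ, Continuous g → HasCompactSupport g →
          tsupport g ⊆ {z | |tCoord m η z| < a ∧ |nCoord m η z| < b} →
          ∀ r ε : ℝ, 0 < r → 0 < ε →
            ∀ᶠ k : ℕ in atTop, ∀ (hδ : (Λ (u (s k))).IsZdAdmissible) (ω₀ : BondConfig (Site 2)) (n : ℕ),
              n < exitTime hδ ω₀ →
              (∀ z ∈ prefixTrace (Λ (u (s k))) n ω₀, ∀ w : ℂ,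
                |tCoord m η w| ≤ a → |nCoord m η w| ≤ b → r ≤ dist z w) →
              let U : Set ℂ := connectedComponentIn
                ((familyFaceDomain hΛ.zd hδ).carrier \ prefixTrace (Λ (u (s k))) n ω₀) (m + ((b / 2 : ℝ) : ℂ) * η)
              let N : ℝ := touchFunctionalPin (Λ (u (s k))) (ω₀ ∩ revealedFreeEdges hδ ω₀ n)
                (revealedFreeEdges hδ ω₀ n \ ω₀) g
              (tipAccess (Λ (u (s k))) n ω₀ ⊆ U →
                ∃ (ρ : ℂ → ℝ) (d : ℝ), 0 ≤ d ∧ d ≤ u (s k) ∧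
                  (∀ y : ℂ, |tCoord m η y| < a → nCoord m η y = 0 →
                    HasPinTouchDensityAt U (tipAccess (Λ (u (s k))) n ω₀) (prefixTip (Λ (u (s k))) n ω₀)
                      ((familyFaceDomain hΛ.zd hδ).pt 1) (y + (d : ℂ) * η) (ρ y)) ∧
                  |N - c * ∫ t in Set.Ioo (-a) a,
                      g (m + (t : ℂ) * (Complex.I * η)) * ρ (m + (t : ℂ) * (Complex.I * η))| ≤ ε) ∧
              (¬ tipAccess (Λ (u (s k))) n ω₀ ⊆ U → |N| ≤ ε)

/-- **The corrected S6 (proposal): `(∀ D, IsRectilinear D → TouchLawPosPin D) → TightOnRectilinear ∧ IdentOnRectilinear`.**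
Stated as a `Prop` (nothing asserted). Its tightness conjunct is `tightOnRectilinear` (landed); its identification
conjunct still contains (J′) Loewner describability of subsequential limits of the (non-simple) medial interface
(Kemppainen–Smirnov for percolation families — the tree's named KS fact is for simple curves), the Loewner transport of the
window density `ρ_{D_t}(y) = |g_t′(ψ y)|^{1/3}|ψ′(y)|^{1/3}|g_t(ψ y) − W_t|^{-1/3}`, and the `κ = 6` continuum step
for this BOUNDARY functional (a clone of the landed `…StubSleSixOfLimitData` / `Literature/…/ParaObservableSLESix` for the
bulk spin-`1/3` observable: same far-field coefficients). -/
def S6Corrected : Prop :=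
  (∀ D : DobrushinDomain, IsRectilinear D → TouchLawPosPin D) → TightOnRectilinear ∧ IdentOnRectilinear

/-- The tightness conjunct of the corrected S6 is unconditional (`…IicTight.tightOnRectilinear`): only the
identification conjunct consumes `TouchLawPosPin`. -/
theorem s6Corrected_iff : S6Corrected ↔ ((∀ D : DobrushinDomain, IsRectilinear D → TouchLawPosPin D) → IdentOnRectilinear) :=
  ⟨fun h hP => (h hP).2, fun h hP => ⟨tightOnRectilinear, h hP⟩⟩

end Summit.CriticalPhenomena.CardyFormulaZ2.Cruxes.ParafermionToSLESixFamilies.IicTraceFluxPairing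

end
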